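import Mathlib

/-!
# The reflective class of the generic twistor fibre of an exact anchor

Solo-blind residency `solo-HodgeConjecture-blind`, K3-similarity face (door H), s20,
`paper/k3-weil-faces.md` §2.10.5(b).

Let `S` be a K3 surface and `v = (r, 0, s)` a primitive Mukai vector (`gcd(r,s) = 1`, `r ≥ 1`, `s ≠ 0`).
The Mukai lattice is `H²(S,ℤ) ⊕ U` with `U = {(α, β)}`, pairing `⟪(α,β),(α',β')⟫ = -(α β' + α' β)`, and
`H²(S,ℤ) ⟂ U`.  Then `v^⟂ = H²(S,ℤ) ⊕ ℤ u` with `u = (r, 0, -s)`, and the facts certified below are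
`⟪v,v⟫ = -2rs`, `⟪u,u⟫ = 2rs = -⟪v,v⟫`, `⟪u,v⟫ = 0`, and
`{⟪w,u⟫ : w ∈ v^⟂} = 2rs·ℤ` (the `H²`-component of `w` pairs trivially with `u`, so only the
`U`-component `(α,β)` with `α s + r β = 0` matters): the divisibility of `u` in `v^⟂` is `2|rs| = 2(n-1)`
where `2n - 2 = ⟪v,v⟫`.  Together with `⟪u,u⟫ = 2 - 2n` this makes `u` a monodromy-reflective class of
`K3^[n]`-type with Markman invariant `{r,s}(u) = {r,|s|}` (Markman, arXiv:1101.4606, Example 9.20), which is the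
Hilbert–Chow type `{1, n-1}` only if `min(r,|s|) = 1`.  For the fibres `F_x` of an exact anchor in the
untwisted sector one has `r ≥ 2` and `c₂(F_x) ≥ 2r` (the χ-bound of §2.10.5(a)), i.e. `|s| = c₂ - r ≥ r ≥ 2`
(`not_hilbertChow_type`): the generic twistor fibre is never of Hilbert–Chow type, so Verbitsky's theorem on
trianalytic subvarieties of Hilbert schemes (alg-geom/9705004, Thm 1.1) does not apply to it.
-/

namespace Summit.HodgeConjecture.HodgeConjecture.Theorems

/-- Mukai pairing on the hyperbolic summand `U = H⁰ ⊕ H⁴`: `⟪(α,β),(α',β')⟫ = -(αβ' + α'β)`. -/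
def mukaiU (p q : ℤ × ℤ) : ℤ := -(p.1 * q.2 + q.1 * p.2)

/-- `⟪v,v⟫ = -2rs` for `v = (r,0,s)`. -/
theorem mukaiU_v_v (r s : ℤ) : mukaiU (r, s) (r, s) = -(2 * r * s) := by
  simp [mukaiU]; ring

/-- `⟪u,u⟫ = 2rs` for `u = (r,0,-s)`. -/
theorem mukaiU_u_u (r s : ℤ) : mukaiU (r, -s) (r, -s) = 2 * r * s := by
  simp [mukaiU]; ring

/-- `u = (r,0,-s)` is orthogonal to `v = (r,0,s)`. -/
theorem mukaiU_u_v (r s : ℤ) : mukaiU (r, -s) (r, s) = 0 := by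
  simp [mukaiU]

/-- The `U`-component `(α, β)` of a vector of `v^⟂`, `v = (r,0,s)`, satisfies `α s + r β = 0`
(`mukaiU (α,β) (r,s) = 0`), and then pairs with `u = (r,0,-s)` to `-2 r β`. -/
theorem mukaiU_w_u (r s α β : ℤ) (h : mukaiU (α, β) (r, s) = 0) :
    mukaiU (α, β) (r, -s) = -(2 * r * β) := by
  simp [mukaiU] at h ⊢
  linarith

/-- Divisibility of the reflective class: every `w ∈ v^⟂` pairs with `u` into `2rs·ℤ`
(for coprime `r`, `s`). -/
theorem mukaiU_div_reflective (r s α β : ℤ) (hc : IsCoprime r s)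
    (h : mukaiU (α, β) (r, s) = 0) : 2 * r * s ∣ mukaiU (α, β) (r, -s) := by
  rw [mukaiU_w_u r s α β h]
  have h0 : α * s + r * β = 0 := by simp [mukaiU] at h; linarith
  have hsb : s ∣ r * β := ⟨-α, by linarith⟩
  obtain ⟨k, hk⟩ := (IsCoprime.symm hc).dvd_of_dvd_mul_left hsb
  exact ⟨-k, by rw [hk]; ring⟩

/-- The divisibility `2rs` is attained (by `w = (r, 0, -s) = u` itself, which lies in `v^⟂`). -/
theorem mukaiU_div_attained (r s : ℤ) :
    mukaiU (r, -s) (r, s) = 0 ∧ mukaiU (r, -s) (r, -s) = 2 * r * s :=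
  ⟨mukaiU_u_v r s, mukaiU_u_u r s⟩

/-- Numerology of the untwisted sector: rank `r ≥ 2` and the χ-bound `c₂ ≥ 2r` force both members of the
Markman pair `{r, c₂ - r}` to be `≥ 2`, so the pair is not the Hilbert–Chow pair `{1, n-1}`. -/
theorem not_hilbertChow_type (r c₂ : ℕ) (hr : 2 ≤ r) (hχ : 2 * r ≤ c₂) :
    2 ≤ min r (c₂ - r) ∧ r ≠ 1 ∧ c₂ - r ≠ 1 := by
  refine ⟨?_, by omega, by omega⟩
  simp only [le_min_iff]
  omega

/-- χ-bound arithmetic on a K3 surface: for a bundle `E` of rank `r` with `c₁ = 0` one has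
`χ(E) = 2r - c₂(E)` (Riemann–Roch with `td(S) = 1 + 2[pt]`), so `χ(E) ≤ 0 ↔ c₂(E) ≥ 2r`; for the
Mukai vector `v = (r, 0, s)`, `s = χ - r = r - c₂`, this reads `r + s ≤ 0`. -/
theorem chi_bound_iff (r c₂ : ℤ) : 2 * r - c₂ ≤ 0 ↔ 2 * r ≤ c₂ := by
  constructor <;> intro h <;> linarith

/-- The χ-bound `c₂ ≥ 2r` in Mukai coordinates `v = (r,0,s)`, `s = r - c₂`: `r + s ≤ 0`. -/
theorem chi_bound_mukai (r c₂ : ℤ) (h : 2 * r ≤ c₂) : r + (r - c₂) ≤ 0 := by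
  linarith

end Summit.HodgeConjecture.HodgeConjecture.Theorems
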